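import Mathlib
import Summits.SmoothPoincare4.SmoothPoincare4.Theses.CongruenceShadows

/-!
# Sketch — crux-ideate, crux `ShadowsStandard` (stmt-SmoothPoincare4-14593), round 1, ideator 1

First lemmas of the two crux idea cards filed by this seat:

* card A `power-twist-absorption`: `map_sup_eq_of_congruentMod` (twist absorption, proved),
  `standardAt_of_gateFactorisation` (the mod-`M` gate criterion, proved);
* card B `prym-layer-stable-rank`: `residual`, `StepAt`, `standardAt_mono` (proved),
  `shadowsStandard_of_stepAt` (exact chief-layer reduction, statement only), `prymLevel`,
  `PrymStep`.

Everything is stated over the route file `Theses/CongruenceShadows.lean` and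
`Literature/Topology/FourManifolds/GroupTrisections.lean`; nothing here is an item.
-/

noncomputable section

namespace Summit.SmoothPoincare4.SmoothPoincare4.Cruxes.ShadowsStandard.IdeatorOne

open Literature.Topology.FourManifolds
open Summit.SmoothPoincare4.SmoothPoincare4.Theses.CongruenceShadows

/-- The surface group of the crux at parameter `m` (genus `3 + 3m`). -/
abbrev Sg (m : ℕ) : Type := SurfaceGroup (3 + 3 * m)

/-- The standard kernel triple `N = s4Kernels.stabilizeIter m`. -/
abbrev Nstd (m : ℕ) : TrisectionKernels (3 + 3 * m) := s4Kernels.stabilizeIter m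

/-- Level-`M` shadow standardness of a kernel triple `K` (the matrix of the crux at one level). -/
def StandardAt (m : ℕ) (K : TrisectionKernels (3 + 3 * m)) (M : Subgroup (Sg m)) : Prop :=
  ∃ ψ : Sg m ≃* Sg m, ∀ i : Fin 3, (Nstd m i ⊔ M).map ψ.toMonoidHom = K i ⊔ M

/-- `ShadowsStandard` is literally "standard at every characteristic finite-index level". -/
theorem shadowsStandard_iff :
    ShadowsStandard ↔ ∀ (m : ℕ) (K : TrisectionKernels (3 + 3 * m)),
      IsGroupTrisection (3 + 3 * m) (m + 1) (PUnit : Type) K →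
      ∀ M : Subgroup (Sg m), M.Characteristic → M.FiniteIndex → StandardAt m K M :=
  Iff.rfl

/-! ## Card A — power-twist absorption -/

/-- `φ ≡ id (mod M)`: the algebraic shadow of the level-`M` congruence kernel of `Mod(Σ)`. When `M`
is characteristic and `exp(S/M) ∣ e`, the automorphism induced by the `e`-th power of ANY Dehn
twist satisfies this (card A, informal: for `γ` non-separating choose a geometric basis with
`γ = a₁`, then `T_γ^e : b₁ ↦ b₁ a₁^{±e}`, other generators fixed; for `γ` separating `T_γ^e` is a
partial conjugation by `w_γ^e ∈ M`; characteristic-ness of `M` transports this along `Mod`). -/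
def CongruentMod {m : ℕ} (M : Subgroup (Sg m)) (φ : Sg m ≃* Sg m) : Prop :=
  ∀ s : Sg m, φ s * s⁻¹ ∈ M

/-- **Twist absorption (card A, first lemma).** An automorphism congruent to the identity modulo
`M` fixes every level-`M` shadow `K ⊔ M`. (No normality needed.) -/
theorem map_sup_eq_of_congruentMod {m : ℕ} (M : Subgroup (Sg m)) (φ : Sg m ≃* Sg m)
    (hφ : CongruentMod M φ) (K : Subgroup (Sg m)) :
    (K ⊔ M).map φ.toMonoidHom = K ⊔ M := by
  apply le_antisymm
  · rintro _ ⟨x, hx, rfl⟩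
    have h1 : φ x * x⁻¹ ∈ K ⊔ M := Subgroup.mem_sup_right (hφ x)
    have h2 : (φ x * x⁻¹) * x ∈ K ⊔ M := Subgroup.mul_mem _ h1 hx
    simpa using h2
  · intro x hx
    refine ⟨φ.symm x, ?_, by simp⟩
    have h1 : φ (φ.symm x) * (φ.symm x)⁻¹ ∈ M := hφ (φ.symm x)
    rw [MulEquiv.apply_symm_apply] at h1
    have h2 : (x * (φ.symm x)⁻¹)⁻¹ * x ∈ K ⊔ M :=
      Subgroup.mul_mem _ (Subgroup.inv_mem _ (Subgroup.mem_sup_right h1)) hx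
    have h3 : (x * (φ.symm x)⁻¹)⁻¹ * x = φ.symm x := by group
    simpa [h3] using h2

/-- A congruent automorphism maps `M` onto itself. -/
theorem map_eq_of_congruentMod {m : ℕ} (M : Subgroup (Sg m)) (φ : Sg m ≃* Sg m)
    (hφ : CongruentMod M φ) : M.map φ.toMonoidHom = M := by
  simpa using map_sup_eq_of_congruentMod M φ hφ M

/-- **Mod-`M` gate criterion (card A).** Normalised triple `K = (N₀, N₁, y(t(c(N₂))))` with `y` in
the Goeritz group of the spine (stabilises `N₀`, `N₁`; and `M`, automatic for `M` characteristic),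
`t ≡ id (mod M)` (e.g. a product of `e`-th powers of Dehn twists, `exp(S/M) ∣ e`), `c` in the
handlebody group of `N₂`: then the level-`M` shadow of `K` is standard, witnessed by `ψ = y`. -/
theorem standardAt_of_gateFactorisation {m : ℕ} (M : Subgroup (Sg m))
    (K : TrisectionKernels (3 + 3 * m)) (y t c : Sg m ≃* Sg m)
    (hK0 : K 0 = Nstd m 0) (hK1 : K 1 = Nstd m 1)
    (hK2 : K 2 = (((Nstd m 2).map c.toMonoidHom).map t.toMonoidHom).map y.toMonoidHom)
    (hy0 : (Nstd m 0).map y.toMonoidHom = Nstd m 0)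
    (hy1 : (Nstd m 1).map y.toMonoidHom = Nstd m 1)
    (hyM : M.map y.toMonoidHom = M) (ht : CongruentMod M t)
    (hc : (Nstd m 2).map c.toMonoidHom = Nstd m 2) :
    StandardAt m K M := by
  have htM : M.map t.toMonoidHom = M := map_eq_of_congruentMod M t ht
  have hbase : (Nstd m 2).map t.toMonoidHom ⊔ M = Nstd m 2 ⊔ M := by
    calc (Nstd m 2).map t.toMonoidHom ⊔ M
        = (Nstd m 2).map t.toMonoidHom ⊔ M.map t.toMonoidHom := by rw [htM]
      _ = (Nstd m 2 ⊔ M).map t.toMonoidHom := (Subgroup.map_sup _ _ _).symm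
      _ = Nstd m 2 ⊔ M := map_sup_eq_of_congruentMod M t ht _
  refine ⟨y, ?_⟩
  intro i
  fin_cases i
  · change (Nstd m 0 ⊔ M).map y.toMonoidHom = K 0 ⊔ M
    rw [Subgroup.map_sup, hy0, hyM, hK0]
  · change (Nstd m 1 ⊔ M).map y.toMonoidHom = K 1 ⊔ M
    rw [Subgroup.map_sup, hy1, hyM, hK1]
  · change (Nstd m 2 ⊔ M).map y.toMonoidHom = K 2 ⊔ M
    rw [hK2, hc, ← hbase, Subgroup.map_sup, hyM]

/-- The mod-`M` gate for the whole route parameter `m` (card A's typable kernel of the "mod-`e`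
gate": `t` ranges over ALL automorphisms congruent to `id` mod `M`, a priori more than the
closure of `e`-th powers of twists). -/
def CongruenceGate (m : ℕ) : Prop :=
  ∀ K : TrisectionKernels (3 + 3 * m),
    IsGroupTrisection (3 + 3 * m) (m + 1) (PUnit : Type) K → K 0 = Nstd m 0 → K 1 = Nstd m 1 →
    ∀ M : Subgroup (Sg m), M.Characteristic → M.FiniteIndex →
    ∃ y t c : Sg m ≃* Sg m,
      (Nstd m 0).map y.toMonoidHom = Nstd m 0 ∧ (Nstd m 1).map y.toMonoidHom = Nstd m 1 ∧
      CongruentMod M t ∧ (Nstd m 2).map c.toMonoidHom = Nstd m 2 ∧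
      K 2 = (((Nstd m 2).map c.toMonoidHom).map t.toMonoidHom).map y.toMonoidHom

/-- Card A's line: pairs normalised by `WaldhausenPairs` (crux of the route, a theorem in print),
then the mod-`M` gate gives `ShadowsStandard`. Statement only (the normalisation bookkeeping —
transporting `K` by the inverse of the pair-standardiser — is routine). -/
def CardALine : Prop := WaldhausenPairs → (∀ m, CongruenceGate m) → ShadowsStandard

/-! ## Card B — chief layers: exact reduction, Prym layers -/

/-- The `T`-residual of `M` computed inside `S`: `R_T(M) = ⋂_{f : M →* T} ker f` (characteristic in
`S` and of finite index when `M` is and `T` is finite). -/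
def residual {m : ℕ} (M : Subgroup (Sg m)) (T : Type) [Group T] : Subgroup (Sg m) :=
  (⨅ f : M →* T, f.ker).map M.subtype

/-- One chief-layer step of type `T` below level `M`. -/
def StepAt (m : ℕ) (K : TrisectionKernels (3 + 3 * m)) (M : Subgroup (Sg m))
    (T : Type) [Group T] : Prop :=
  StandardAt m K M → StandardAt m K (residual M T)

/-- **Monotonicity (proved).** Standard at a deeper level `M' ≤ M` with `M` characteristic implies
standard at `M` — so cofinal families of levels suffice. -/
theorem standardAt_mono {m : ℕ} {K : TrisectionKernels (3 + 3 * m)} {M M' : Subgroup (Sg m)}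
    (hle : M' ≤ M) (hM : M.Characteristic) (h : StandardAt m K M') : StandardAt m K M := by
  obtain ⟨ψ, hψ⟩ := h
  refine ⟨ψ, fun i => ?_⟩
  have hψM : M.map ψ.toMonoidHom = M := (Subgroup.characteristic_iff_map_eq.mp hM) ψ
  have hMM : M' ⊔ M = M := sup_eq_right.mpr hle
  calc (Nstd m i ⊔ M).map ψ.toMonoidHom
      = (Nstd m i ⊔ M' ⊔ M).map ψ.toMonoidHom := by rw [sup_assoc, hMM]
    _ = (Nstd m i ⊔ M').map ψ.toMonoidHom ⊔ M.map ψ.toMonoidHom := Subgroup.map_sup _ _ _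
    _ = K i ⊔ M' ⊔ M := by rw [hψ, hψM]
    _ = K i ⊔ M := by rw [sup_assoc, hMM]

/-- **Exact chief-layer reduction (card B, first lemma; statement).** If every simple-type layer
step holds below every characteristic finite-index level, the crux holds: induct on `[M : M']`
along a characteristic series, each factor refined by a residual `R_T`, and climb back with
`standardAt_mono`; the base level `M = ⊤` is trivial (`ψ = 1`). -/
def ChiefLayerReduction : Prop :=
  (∀ (m : ℕ) (K : TrisectionKernels (3 + 3 * m)),
      IsGroupTrisection (3 + 3 * m) (m + 1) (PUnit : Type) K →
      ∀ M : Subgroup (Sg m), M.Characteristic → M.FiniteIndex →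
      ∀ (T : Type) [Group T] [Finite T], IsSimpleGroup T → StepAt m K M T) →
    ShadowsStandard

/-- The Prym level `M^p [M,M]` inside `S`: `π₁` of the mod-`p` homology cover of `Σ̃_M`; the layer
`M / M^p[M,M] = H₁(Σ̃_M; 𝔽_p)` is the symplectic `𝔽_p[S/M]`-module on which card B works. -/
def prymLevel {m : ℕ} (M : Subgroup (Sg m)) (p : ℕ) : Subgroup (Sg m) :=
  (⁅(⊤ : Subgroup M), (⊤ : Subgroup M)⁆ ⊔ Subgroup.closure (Set.range fun x : M => x ^ p)).map
    M.subtype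

/-- The abelian (Prym) layer step: the `C_p`-residual of `M` is `M^p[M,M]`, so `PrymStep` for all
primes `p` is exactly `StepAt` for all abelian simple `T`; card B's lever (Fox calculus over the
Artinian ring `𝔽_p[S/M]`, Bass stable rank one, lifted-twist transvections) targets this step. -/
def PrymStep (m : ℕ) (K : TrisectionKernels (3 + 3 * m)) (M : Subgroup (Sg m)) (p : ℕ) : Prop :=
  StandardAt m K M → StandardAt m K (prymLevel M p)

/-- All abelian layers at once = "solvable shadows are standard relative to any standard level". -/
def SolvableDescent (m : ℕ) : Prop :=
  ∀ K : TrisectionKernels (3 + 3 * m), IsGroupTrisection (3 + 3 * m) (m + 1) (PUnit : Type) K →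
    ∀ M : Subgroup (Sg m), M.Characteristic → M.FiniteIndex → ∀ p : ℕ, p.Prime → PrymStep m K M p

end Summit.SmoothPoincare4.SmoothPoincare4.Cruxes.ShadowsStandard.IdeatorOne
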